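import Summits.BirchSwinnertonDyer.BirchSwinnertonDyer.Theses.ShaPrimaryTransfer
import Summits.BirchSwinnertonDyer.BirchSwinnertonDyer.Theorems.ShaPrimaryTransferFiniteShaComponentTransferSectors
import Literature.NumberTheory.EllipticCurves.CastellaGrossiLeeSkinner2022.PConverse
import Literature.NumberTheory.EllipticCurves.CastellaWan2024.SupersingularPConverse
import Literature.NumberTheory.EllipticCurves.BSDSelmerParityDokchitserProofs

/-!
# BirchSwinnertonDyer / ShaPrimaryTransfer — crux `FiniteShaComponentTransfer` (stmt-BirchSwinnertonDyer-22356):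
# the EISENSTEIN door (Castella–Grossi–Lee–Skinner 2022 Thm. E) and the SUPERSINGULAR door of a
# semistable curve (Castella–Wan 2024 Thm. A) in rank ≤ 1

Eighth helper file of prover seat `bsd-line-spt-p1` (`--supports stmt-22356 --as helper`). The companion `…Sectors`
(g0) closes the transfer `t_p(E) = 0 ⟹ t_q(E) = 0` out of a good ORDINARY door prime `p ≥ 5` with `E[p]` IRREDUCIBLE
in algebraic rank ≤ 1, and names as open residue «a door prime that is 2, 3, bad, supersingular, or Eisenstein for
a non-CM curve». Two of these cells are covered by `p`-converse theorems the tree already carries verbatim: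

* EISENSTEIN door — Castella–Grossi–Lee–Skinner, Invent. Math. 227 (2022), Thm. E, both ranks (named facts
  `CastellaGrossiLeeSkinner2022.thmE_analyticRank_eq_zero_of_selmerCorank_eq_zero` / `…_eq_one_…`): `p > 2` of
  good reduction with `E[p]` REDUCIBLE and non-anomalous (`¬ Anom W p`, i.e. `φ|_{G_p} ≠ 1, ω`):
  `transfer_doorEisenstein_rank_zero`, `transfer_doorEisenstein_rank_one`, `transfer_doorEisenstein_rank_le_one`
  (mod Thm. E + GZK).
* SUPERSINGULAR door of a SEMISTABLE curve — Castella–Wan, Math. Ann. 389 (2024), Thm. A (named fact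
  `CastellaWan2024.thmA_analyticRank_eq_one_of_selmerCorank_eq_one`): `p > 3` good supersingular, `E` semistable,
  rank `1`: `transfer_doorSupersingular_semistable_rank_one` (mod Thm. A + GZK).
* SYNTHESIS at a good ordinary `p ≥ 5` in rank ≤ 1 (`transfer_rank_le_one_of_goodOrdinary_of_not_anom`): irreducible
  `E[p]` by `…Sectors` (BCS 2025 + modularity in rank 0, Kim 2022 / Burungale–Tian 2020 in rank 1), reducible
  non-anomalous `E[p]` by Thm. E — so at good ordinary `p ≥ 5` the rank ≤ 1 residue of T is exactly the ANOMALOUS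
  Eisenstein door (`E[p]` reducible with `a_p ≡ 1 (mod p)`).

Numbers, not adjectives — after `…Sectors`, `…DoorAtTwo`, `…DoorAtThree`, `…DoorSkinnerC`, `…DoorCM` and this file,
the rank ≤ 1 residue of T in door coordinates is: door at `2` (non-CM: items 19218/19219/19220 of `TwoAdicConverse`;
CM rank 1: crux B 19080 and its un-filed cousins); door at `3` without (surj/irr + ram); anomalous Eisenstein doors;
supersingular doors of NON-semistable non-CM curves (rank 1) and ALL rank-0 supersingular non-CM doors (the ± main
conjecture converse is not vendored); multiplicative doors in rank 1 and without (irr)+(ram) in rank 0; additive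
doors of non-CM curves; and everything in rank ≥ 2. CONDITIONAL on the named hypotheses; nothing here proves T or BSD.

References: F. Castella, G. Grossi, J. Lee, C. Skinner, Invent. Math. 227 (2022), Thm. E; F. Castella, X. Wan,
Math. Ann. 389 (2024), Thm. A; A. Burungale, F. Castella, C. Skinner, IMRN (2025), Thm. 1.1.2; C.-H. Kim, Math. Ann.
387 (2022), Cor. 1.4; A. Burungale, Y. Tian, Invent. Math. 220 (2020), Thm. 1.2; V. Kolyvagin (1990), Thm. A /
Gross–Zagier (1986) via H. Darmon, CBMS 101 (2004), Thm. 3.22.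
-/

-- D-0017: single-problem summit, so `Summit.BirchSwinnertonDyer.BirchSwinnertonDyer.…` repeats a namespace BY DESIGN.
set_option linter.dupNamespace false

noncomputable section

namespace Summit.BirchSwinnertonDyer.BirchSwinnertonDyer.Theorems.ShaPrimaryTransferDoorEisensteinSS

open scoped Classical
open Literature.NumberTheory.EllipticCurves Literature.NumberTheory.EllipticCurves.Rank1Residual
open Literature.NumberTheory.EllipticCurves.ModularForms (exists_isNewformOf)
open WeierstrassCurve
open Summit.BirchSwinnertonDyer.BirchSwinnertonDyer.Theorems

/-! ## §1 The Eisenstein door (CGLS 2022 Thm. E) -/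

/-- **Eisenstein door, rank `0` (CGLS Thm. E + GZK).** For `E/ℚ` on a global minimal model with `rank E(ℚ) = 0`, a
prime `p > 2` of good reduction with `E[p]` reducible and non-anomalous, and `t_p(E) = corank_{ℤ_p} Ш(E)[p^∞] = 0`:
every `t_q(E)` vanishes (`corank Sel_{p^∞} = 0` by Greenberg's identity; `ord_{s=1} L(E,s) = 0` by Thm. E, `hE0`;
`Ш(E/ℚ)` finite by GZK, `hGZK`). CONDITIONAL on `hE0`, `hGZK`.
[cite: CastellaGrossiLeeSkinner2022, Theorem E = Thm. 5.2.1] [cite: Darmon2004, Thm. 3.22 (= Thm. 1.14) and §3.9] -/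
theorem transfer_doorEisenstein_rank_zero
    (hE0 : CastellaGrossiLeeSkinner2022.thmE_analyticRank_eq_zero_of_selmerCorank_eq_zero)
    (hGZK : rank_eq_analyticRank_of_analyticRank_le_one)
    (W : WeierstrassCurve ℚ) [W.IsElliptic] [W.IsGloballyMinimal] (p q : ℕ) [Fact p.Prime] [Fact q.Prime]
    (hp : 2 < p) (hgood : Good W p) (hred : Red W p) (hna : ¬ Anom W p)
    (hr : W.mordellWeilRank = 0) (h0 : W.shaCorank p = 0) : W.shaCorank q = 0 := by
  have hs : W.selmerCorank p = 0 := by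
    rw [W.selmerCorank_eq_mordellWeilRank_add_holds p, hr, h0]
  have ha : W.analyticRank = 0 := hE0 W p hp hgood hred hna hs
  haveI : Finite ↥W.sha := (hGZK W (by omega)).2
  exact W.shaCorank_eq_zero_of_finite q

/-- **Eisenstein door, rank `1` (CGLS Thm. E + GZK).** As above with `rank E(ℚ) = 1`: `corank Sel_{p^∞} = 1`,
Thm. E (`hE1`) gives `ord_{s=1} L(E,s) = 1`, GZK closes. CONDITIONAL on `hE1`, `hGZK`.
[cite: CastellaGrossiLeeSkinner2022, Theorem E = Thm. 5.2.1] [cite: Darmon2004, Thm. 3.22 (= Thm. 1.14) and §3.9] -/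
theorem transfer_doorEisenstein_rank_one
    (hE1 : CastellaGrossiLeeSkinner2022.thmE_analyticRank_eq_one_of_selmerCorank_eq_one)
    (hGZK : rank_eq_analyticRank_of_analyticRank_le_one)
    (W : WeierstrassCurve ℚ) [W.IsElliptic] [W.IsGloballyMinimal] (p q : ℕ) [Fact p.Prime] [Fact q.Prime]
    (hp : 2 < p) (hgood : Good W p) (hred : Red W p) (hna : ¬ Anom W p)
    (hr : W.mordellWeilRank = 1) (h0 : W.shaCorank p = 0) : W.shaCorank q = 0 := by
  have hs : W.selmerCorank p = 1 := by
    rw [W.selmerCorank_eq_mordellWeilRank_add_holds p, hr, h0]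
  have ha : W.analyticRank = 1 := hE1 W p hp hgood hred hna hs
  haveI : Finite ↥W.sha := (hGZK W (by omega)).2
  exact W.shaCorank_eq_zero_of_finite q

/-- **Eisenstein door, rank `≤ 1`** (the two previous theorems). CONDITIONAL on `hE0`, `hE1`, `hGZK`.
[cite: CastellaGrossiLeeSkinner2022, Theorem E = Thm. 5.2.1] [cite: Darmon2004, Thm. 3.22 (= Thm. 1.14) and §3.9] -/
theorem transfer_doorEisenstein_rank_le_one
    (hE0 : CastellaGrossiLeeSkinner2022.thmE_analyticRank_eq_zero_of_selmerCorank_eq_zero)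
    (hE1 : CastellaGrossiLeeSkinner2022.thmE_analyticRank_eq_one_of_selmerCorank_eq_one)
    (hGZK : rank_eq_analyticRank_of_analyticRank_le_one)
    (W : WeierstrassCurve ℚ) [W.IsElliptic] [W.IsGloballyMinimal] (p q : ℕ) [Fact p.Prime] [Fact q.Prime]
    (hp : 2 < p) (hgood : Good W p) (hred : Red W p) (hna : ¬ Anom W p)
    (hr : W.mordellWeilRank ≤ 1) (h0 : W.shaCorank p = 0) : W.shaCorank q = 0 := by
  rcases Nat.le_one_iff_eq_zero_or_eq_one.1 hr with hr0 | hr1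
  · exact transfer_doorEisenstein_rank_zero hE0 hGZK W p q hp hgood hred hna hr0 h0
  · exact transfer_doorEisenstein_rank_one hE1 hGZK W p q hp hgood hred hna hr1 h0

/-! ## §2 The supersingular door of a semistable curve in rank 1 (Castella–Wan 2024 Thm. A) -/

/-- **Supersingular door, semistable curve, rank `1` (Castella–Wan Thm. A + GZK).** For a SEMISTABLE `E/ℚ` on a
global minimal model with `rank E(ℚ) = 1`, a prime `p > 3` of good supersingular reduction and `t_p(E) = 0`: every
`t_q(E)` vanishes (`corank Sel_{p^∞} = 1`; Thm. A, `hCW`, gives `ord_{s=1} L(E,s) = 1`; GZK). CONDITIONAL on `hCW`,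
`hGZK`. [cite: CastellaWan2023, Thm. A (p. 2596)] [cite: Darmon2004, Thm. 3.22 (= Thm. 1.14) and §3.9] -/
theorem transfer_doorSupersingular_semistable_rank_one
    (hCW : CastellaWan2024.thmA_analyticRank_eq_one_of_selmerCorank_eq_one)
    (hGZK : rank_eq_analyticRank_of_analyticRank_le_one)
    (W : WeierstrassCurve ℚ) [W.IsElliptic] [W.IsGloballyMinimal] (p q : ℕ) [Fact p.Prime] [Fact q.Prime]
    (hp : 3 < p) (hsst : Semistable W) (hss : GoodSS W p)
    (hr : W.mordellWeilRank = 1) (h0 : W.shaCorank p = 0) : W.shaCorank q = 0 := by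
  have hs : W.selmerCorank p = 1 := by
    rw [W.selmerCorank_eq_mordellWeilRank_add_holds p, hr, h0]
  have ha : W.analyticRank = 1 := hCW W p hp hsst hss hs
  haveI : Finite ↥W.sha := (hGZK W (by omega)).2
  exact W.shaCorank_eq_zero_of_finite q

/-! ## §3 Synthesis at a good ordinary prime `p ≥ 5`: only the anomalous Eisenstein door is left in rank ≤ 1 -/

/-- **Rank ≤ 1, door at a good ordinary `p ≥ 5` that is not an anomalous Eisenstein prime.** For `E/ℚ` on a global
minimal model with `rank E(ℚ) ≤ 1`, a prime `p ≥ 5` of good ordinary reduction such that `E[p]` is irreducible OR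
`E[p]` is reducible and `p` non-anomalous, and `t_p(E) = 0`: every `t_q(E)` vanishes — irreducible by `…Sectors`
(`hmod`, `hMC` in rank 0; `hKim`, `hBT1` in rank 1), reducible non-anomalous by CGLS Thm. E (`hE0`, `hE1`), GZK
throughout. CONDITIONAL on the seven named facts. [cite: CastellaGrossiLeeSkinner2022, Theorem E = Thm. 5.2.1]
[cite: BurungaleCastellaSkinner2025, Thm. 1.1.2 (a)] [cite: Kim2022, Cor. 1.4] [cite: BurungaleTian2019, Thm. 1.2 (p. 214)]
[cite: Darmon2004, Thm. 3.22 (= Thm. 1.14) and §3.9] -/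
theorem transfer_rank_le_one_of_goodOrdinary_of_not_anom
    (hmod : exists_isNewformOf) (hMC : burungale_castella_skinner_charIdeal_eq_padicLFunction)
    (hKim : kim_analyticRank_eq_one_of_mordellWeilRank_eq_one)
    (hBT1 : burungaleTian_analyticRank_eq_one_of_selmerCorank_eq_one_of_hasCM)
    (hE0 : CastellaGrossiLeeSkinner2022.thmE_analyticRank_eq_zero_of_selmerCorank_eq_zero)
    (hE1 : CastellaGrossiLeeSkinner2022.thmE_analyticRank_eq_one_of_selmerCorank_eq_one)
    (hGZK : rank_eq_analyticRank_of_analyticRank_le_one)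
    (W : WeierstrassCurve ℚ) [W.IsElliptic] [W.IsGloballyMinimal] (p q : ℕ) [Fact p.Prime] [Fact q.Prime]
    (hp : 5 ≤ p) (hgood : W.HasGoodReductionAtPrime p) (hord : ¬ (p : ℤ) ∣ W.frobeniusTrace p)
    (himg : W.HasIrreducibleModPGaloisRep p ∨ ¬ Anom W p)
    (hr : W.mordellWeilRank ≤ 1) (h0 : W.shaCorank p = 0) : W.shaCorank q = 0 := by
  by_cases hirr : W.HasIrreducibleModPGaloisRep p
  · exact ShaPrimaryTransferSectors.transfer_of_mordellWeilRank_le_one_of_goodOrdinary hmod hMC hKim hBT1 hGZK W p q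
      hp hgood hord (fun _ => hirr) hr h0
  · have hna : ¬ Anom W p := himg.resolve_left hirr
    exact transfer_doorEisenstein_rank_le_one hE0 hE1 hGZK W p q (by omega) hgood hirr hna hr h0

end Summit.BirchSwinnertonDyer.BirchSwinnertonDyer.Theorems.ShaPrimaryTransferDoorEisensteinSS
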